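import Literature.NumberTheory.IwasawaTheory.ClassicalMuVanishesDivisionFieldFiveNonsplit
import Literature.NumberTheory.EllipticCurves.FineSelmerLayerCriterionRat
import Literature.NumberTheory.NumberFields.ClassGroupRankEqualityCyclotomicTowerSaturated
import Literature.RepresentationTheory.FiniteGroups.CosetKernelModuleLift
import HarnessLib

/-!
# Statement (A) of Coates–Sujatha at `(E, 5)` for a `C_ns⁺(5)` image FROM THE RANK EQUALITY `rank_5 Cl(ℚ(P)) = rank_5 Cl(ℚ(x(P)))`
# — no classical `μ`-hypothesis, no growth theorem

Topic `NumberTheory/EllipticCurves` (namespace = path, grouping sub-namespace `CoatesSujatha2005.RankEqualityRoad`).  THEOREM-ONLY file (no definition,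
no named fact, no `sorry`), written by the prover seat `bsd-potss-k8t-c4` g25 (cell `bsd-potss`; `--supports` stmt-BirchSwinnertonDyer-19982; closes
nothing; neither BSD nor Conjecture A is booked for any curve — the conclusion of §2 IS statement (A) at `(E,5)` under displayed per-curve hypotheses).

THE ROAD. `E/K` (`K` a number field; `K = ℚ` in §2) with `Γ_K` acting on `E[5]` through `C_ns⁺(ε)` in a basis `e` (`σ_x ↦ R_ε = (1 ε(4−ε); 4−ε 1)`,
`σ_s ↦ diag(1,4)`), `L = K(E[5])`, `G = Gal(L/K)`, `H = ⟨σ̄_s⟩` (`L^H = K(P)`, `P = e⁻¹(1,0)`), `H′ = ⟨σ̄_x¹²⟩H` (`σ̄_x¹² = −1`, `L^{H′} = K(x(P))`).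
IF `#Cl(L^H)[5] = #Cl(L^{H′})[5]` (`hrank`) and `σ̄_x¹²` lies in the inertia group of every prime `𝔮 ∋ 5` of `L` (`hcI`; inside `C_ns⁺(5)` this is
`4 ∣ e(𝔮|5)`), THEN for every `ℤ_5`-extension `κ` of `K` with a totally ramified prime and every layer `n`, EVERY `Γ_K`-equivariant additive map
`Cl(𝓞_{L·K_n}) → E[5]` is zero (§1); over `ℚ` this feeds conjA-anchor's door L5 (`CoatesSujatha2005.conjA_of_homTrivial_layer_above_p`; (c1) `5 ∤ #G`
is automatic in `C_ns⁺(5)`) and gives statement (A) at `(E, 5)` for every cyclotomic `ℤ_5`-extension (§2).  MECHANISM: the rank-equality transfer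
(`RankEqualityTransfer.equivariantHom_cosetKernel_layer_eq_zero_of_saturated`, k8t-c4 g25: equal `5`-ranks at the bottom + the saturated inertia
condition ⇒ every equivariant `Cl(L·K_n) → C(G; H ≤ H′)` vanishes at every layer — equivariant Iwasawa 1956) and Frobenius reciprocity
(`invariant_lift_of_forall_equivariantHom_eq_zero`: then every `H`-invariant additive character of `Cl(L·K_n)` is `H′`-invariant), applied to the
character «first coordinate of `f`» of an equivariant `f : Cl → E[5]` (`H`-invariant as `σ̄_s = diag(1,4)`): `H′`-invariance at `σ̄_x¹² = −1` forces it
to vanish, and the `σ_x`-translate (`(R_ε)₀₁ = ε(4−ε) ≠ 0`) gives `f = 0`.  No `μ`-invariant of any leaf, no layer computation: the displayed inputs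
are the two bottom class-group ranks and a ramification index.

## References

* J. Coates, R. Sujatha, *Fine Selmer groups of elliptic curves over p-adic Lie extensions*, Math. Ann. 331 (2005), §3 Thm. 3.4, Lemma 3.8. [CoatesSujatha2005]
* S. V. Deo, A. Ray, R. Sujatha, *On the μ equals zero conjecture for fine Selmer groups in Iwasawa theory*, PAMQ 19 (2023), §3 Thm. 3.8. [DeoRaySujatha2023]
* K. Iwasawa, *A note on class numbers of algebraic number fields*, Abh. Math. Sem. Hamburg 20 (1956), §§3–5. [Iwasawa1956]
* J.-P. Serre, *Linear representations of finite groups*, GTM 42 (1977), §7.2 Thm. 13. [SerreLinearRepresentations1977]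
* J.-P. Serre, *Propriétés galoisiennes des points d'ordre fini des courbes elliptiques*, Invent. Math. 15 (1972), §2.2. [Serre1972]
-/

set_option autoImplicit false

noncomputable section

open scoped Classical NumberField Matrix
open WeierstrassCurve Field IntermediateField
  Literature.NumberTheory.GaloisRepresentations Literature.NumberTheory.SerreUniformity
  Literature.NumberTheory.IwasawaTheory
  Literature.NumberTheory.NumberFields Literature.RepresentationTheory.FiniteGroups

namespace Literature.NumberTheory.EllipticCurves.CoatesSujatha2005

namespace RankEqualityRoad

/-! ### §0 Finite facts and general-`k` helpers -/

/-- Orders in `C_ns(2) ≅ 𝔽₂₅ˣ` divide `24`. [folklore] -/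
private theorem c2_pow'' : ∀ a b : ZMod 5, (a, b) ≠ (0, 0) →
    ((!![a, 2 * b; b, a] : Matrix (Fin 2) (Fin 2) (ZMod 5)) ^ 8) ^ 3 = 1 := by
  decide

/-- Orders in `C_ns(3) ≅ 𝔽₂₅ˣ` divide `24`. [folklore] -/
private theorem c3_pow'' : ∀ a b : ZMod 5, (a, b) ≠ (0, 0) →
    ((!![a, 3 * b; b, a] : Matrix (Fin 2) (Fin 2) (ZMod 5)) ^ 8) ^ 3 = 1 := by
  decide

/-- Orders in `C_ns⁺(2) ∖ C_ns(2)` divide `8`. [folklore] -/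
private theorem n2_pow'' : ∀ a b : ZMod 5, (a, b) ≠ (0, 0) →
    ((!![a, -(2 * b); b, -a] : Matrix (Fin 2) (Fin 2) (ZMod 5))) ^ 8 = 1 := by
  decide

/-- Orders in `C_ns⁺(3) ∖ C_ns(3)` divide `8`. [folklore] -/
private theorem n3_pow'' : ∀ a b : ZMod 5, (a, b) ≠ (0, 0) →
    ((!![a, -(3 * b); b, -a] : Matrix (Fin 2) (Fin 2) (ZMod 5))) ^ 8 = 1 := by
  decide

/-- The non-squares of `𝔽₅` are `2` and `3`. [folklore] -/
private theorem eq_two_or_three_of_not_isSquare'' {ε : ZMod 5} (hε : ¬ IsSquare ε) : ε = 2 ∨ ε = 3 := by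
  have key : ∀ e : ZMod 5, e = 0 ∨ e = 1 ∨ e = 4 ∨ e = 2 ∨ e = 3 := by decide
  rcases key ε with h | h | h | h | h
  · exact absurd ⟨0, by rw [h, mul_zero]⟩ hε
  · exact absurd ⟨1, by rw [h, mul_one]⟩ hε
  · exact absurd ⟨2, by rw [h]; decide⟩ hε
  · exact Or.inl h
  · exact Or.inr h

/-- Every element of `C_ns⁺(ε)`, `ε ∈ {2, 3}`, has order dividing `24`. [folklore] -/
private theorem pow_24_eq_one_of_mem'' {ε : ZMod 5} (hε : ε = 2 ∨ ε = 3) {A : Matrix (Fin 2) (Fin 2) (ZMod 5)}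
    (hA : A ∈ nonsplitCartanNormalizer ε) : A ^ 24 = 1 := by
  obtain ⟨a, b, hab, rfl | rfl⟩ := hA
  · rw [show (24 : ℕ) = 8 * 3 by norm_num, pow_mul]
    rcases hε with rfl | rfl
    exacts [c2_pow'' a b hab, c3_pow'' a b hab]
  · rw [show (24 : ℕ) = 8 * 3 by norm_num, pow_mul]
    rcases hε with rfl | rfl
    · rw [n2_pow'' a b hab, one_pow]
    · rw [n3_pow'' a b hab, one_pow]

/-- `R_ε¹² = −1` for `R_ε = (1 ε(4−ε); 4−ε 1)`, `ε ∈ {2, 3}`. [folklore] -/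
private theorem R_pow_twelve' {ε : ZMod 5} (hε : ε = 2 ∨ ε = 3) :
    (!![1, ε * (4 - ε); 4 - ε, 1] : Matrix (Fin 2) (Fin 2) (ZMod 5)) ^ 12 = -1 := by
  rcases hε with rfl | rfl <;> decide

/-- `ε(4 − ε) ≠ 0` for `ε ∈ {2, 3}`. [folklore] -/
private theorem eps_mul_ne_zero {ε : ZMod 5} (hε : ε = 2 ∨ ε = 3) : ε * (4 - ε) ≠ 0 := by
  rcases hε with rfl | rfl <;> decide

/-- In `𝔽₅`, `−r = r` forces `r = 0`. [folklore] -/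
private theorem zmod5_eq_zero_of_neg_eq : ∀ r : ZMod 5, -r = r → r = 0 := by decide

/-- First coordinate of `(1 0; 0 4) v`. [folklore] -/
private theorem diag14_mulVec_zero (w : Fin 2 → ZMod 5) :
    ((!![1, 0; 0, 4] : Matrix (Fin 2) (Fin 2) (ZMod 5)) *ᵥ w) 0 = w 0 := by
  simp [Matrix.mulVec, dotProduct, Fin.sum_univ_two]

/-- First coordinate of `(1 0; 0 4)^k v`. [folklore] -/
private theorem diag14_pow_mulVec_zero (k : ℕ) (w : Fin 2 → ZMod 5) :
    ((!![1, 0; 0, 4] : Matrix (Fin 2) (Fin 2) (ZMod 5)) ^ k *ᵥ w) 0 = w 0 := by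
  induction k generalizing w with
  | zero => rw [pow_zero, Matrix.one_mulVec]
  | succ k ih => rw [pow_succ, ← Matrix.mulVec_mulVec, ih, diag14_mulVec_zero]

/-- First coordinate of `R_ε v`. [folklore] -/
private theorem R_mulVec_zero (ε : ZMod 5) (w : Fin 2 → ZMod 5) :
    ((!![1, ε * (4 - ε); 4 - ε, 1] : Matrix (Fin 2) (Fin 2) (ZMod 5)) *ᵥ w) 0 = w 0 + ε * (4 - ε) * w 1 := by
  simp [Matrix.mulVec, dotProduct, Fin.sum_univ_two]

/-- Two matrices acting alike on all `e P` coincide (`e` onto). [folklore] -/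
private theorem matrix_eq_of_forall_mulVec'' {A : Type*} [AddCommGroup A] {n : ℕ} (e : A ≃+ (Fin 2 → ZMod n))
    {M N : Matrix (Fin 2) (Fin 2) (ZMod n)} (h : ∀ P : A, M *ᵥ e P = N *ᵥ e P) : M = N := by
  have h' : ∀ v, M *ᵥ v = N *ᵥ v := fun v => by simpa using h (e.symm v)
  ext i j
  have := congrFun (h' (Pi.single j 1)) i
  simpa [Matrix.mulVec_single] using this

/-- Restriction `Γ_F → Gal(E/F)` is onto. [folklore] -/
private theorem absRestrictNormalHom_surjective'' {F : Type} [Field F] (E : IntermediateField F (AlgebraicClosure F))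
    [Normal F E] : Function.Surjective (absRestrictNormalHom E) := fun g => by
  obtain ⟨σ, hσ⟩ := AlgEquiv.restrictNormalHom_surjective (AlgebraicClosure F) g
  exact ⟨(Field.absoluteGaloisGroup.toAlgEquiv F).symm σ, hσ⟩

/-- `p ∤ #Gal(L/k)` when every element has order dividing `24` and `p ∤ 24`. [folklore] -/
private theorem not_dvd_card_of_forall_pow_24 {k : Type} [Field k] (L : IntermediateField k (AlgebraicClosure k))
    [FiniteDimensional k L] {p : ℕ} (hp : p.Prime) (hp24 : ¬ p ∣ 24)
    (h24 : ∀ g : L ≃ₐ[k] L, g ^ 24 = 1) : ¬ p ∣ Nat.card (L ≃ₐ[k] L) := by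
  classical
  haveI : Fact p.Prime := ⟨hp⟩
  intro h5
  rw [Nat.card_eq_fintype_card] at h5
  obtain ⟨g, hg⟩ := exists_prime_orderOf_dvd_card p h5
  have h1 : orderOf g ∣ 24 := orderOf_dvd_of_pow_eq_one (h24 g)
  rw [hg] at h1
  exact hp24 h1

/-- `p ∤ [L : k]` from `p ∤ #Gal(L/k)`. [folklore] -/
private theorem not_dvd_finrank_of_not_dvd_card' {k : Type} [Field k] (L : IntermediateField k (AlgebraicClosure k))
    [FiniteDimensional k L] [IsGalois k L] {p : ℕ} (h : ¬ p ∣ Nat.card (L ≃ₐ[k] L)) : ¬ p ∣ Module.finrank k L := by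
  rwa [← IsGalois.card_aut_eq_finrank k L]

/-- `p ∤ #H'` for `H' ≤ Gal(L/k)` when `p ∤ #Gal(L/k)`. [folklore] -/
private theorem not_dvd_card_subgroup'' {k : Type} [Field k] (L : IntermediateField k (AlgebraicClosure k))
    {p : ℕ} (hL : ¬ p ∣ Nat.card (L ≃ₐ[k] L)) (H' : Subgroup (L ≃ₐ[k] L)) [Fintype H'] :
    ¬ p ∣ Fintype.card H' := fun h => by
  apply hL
  refine h.trans ?_
  rw [← Nat.card_eq_fintype_card]
  exact Subgroup.card_subgroup_dvd_card H'

/-- `⟨c⟩ ⊔ H = {cᵐ h}` for `c` central. [folklore] -/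
private theorem exists_zpow_mul_of_mem_zpowers_sup'' {G : Type*} [Group G] (c : G) (hc : ∀ g : G, g * c = c * g)
    (H : Subgroup G) {h' : G} (hh' : h' ∈ Subgroup.zpowers c ⊔ H) : ∃ m : ℤ, ∃ h ∈ H, h' = c ^ m * h := by
  haveI : (Subgroup.zpowers c).Normal := by
    refine ⟨fun a ha g => ?_⟩
    obtain ⟨m, rfl⟩ := Subgroup.mem_zpowers_iff.mp ha
    have hcomm : g * c ^ m = c ^ m * g := (((commute_iff_eq c g).mpr (hc g).symm).zpow_left m).eq.symm
    rw [hcomm, mul_inv_cancel_right]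
    exact ⟨m, rfl⟩
  have h1 : h' ∈ ((Subgroup.zpowers c ⊔ H : Subgroup G) : Set G) := hh'
  rw [Subgroup.normal_mul] at h1
  obtain ⟨i, hi, h, hh, rfl⟩ := Set.mem_mul.mp h1
  obtain ⟨m, rfl⟩ := Subgroup.mem_zpowers_iff.mp hi
  exact ⟨m, h, hh, rfl⟩

/-- The central form of the saturated inertia condition. [folklore] -/
private theorem saturated_of_central' {G : Type*} [Group G] (c : G) (hc : ∀ g : G, g * c = c * g) (H I : Subgroup G)
    (hcI : c ∈ I) (g h' : G) (hh' : h' ∈ Subgroup.zpowers c ⊔ H) : ∃ i ∈ I, ∃ h ∈ H, g * h' = i * g * h := by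
  obtain ⟨m, h, hh, rfl⟩ := exists_zpow_mul_of_mem_zpowers_sup'' c hc H hh'
  refine ⟨c ^ m, I.zpow_mem hcI m, h, hh, ?_⟩
  have hcomm : g * c ^ m = c ^ m * g := (((commute_iff_eq c g).mpr (hc g).symm).zpow_left m).eq.symm
  rw [← mul_assoc, hcomm]

/-! ### §1 Every equivariant `Cl(𝓞_{L·K_n}) → E[5]` vanishes (general number field `K`, `L = K(E[5])` with image in `C_ns⁺(ε)`) -/

set_option maxHeartbeats 1600000 in
set_option synthInstance.maxHeartbeats 400000 in
/-- **Rank equality kills the `E[5]`-isotypic component at every layer.**  `K` a number field, `κ` a `ℤ_5`-extension of `K` with a totally ramified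
prime, `E/K` elliptic with `Γ_K` acting on `E[5]` through `C_ns⁺(ε)` in a basis `e` (`σ_x ↦ R_ε`, `σ_s ↦ diag(1,4)`), `L = K(E[5])`, `H = ⟨σ̄_s⟩`,
`H′ = ⟨σ̄_x¹²⟩H`.  If `#Cl(L^H)[5] = #Cl(L^{H′})[5]` and `σ̄_x¹² ∈ I(𝔮)` for every prime `𝔮 ∋ 5` of `L`, then for every `n` every additive
`Γ_K`-equivariant `f : Cl(𝓞_{L·K_n}) → E[5]` is zero.  (Rank-equality transfer + Frobenius reciprocity on the character «first coordinate of `f`»;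
see the module docstring.) [cite: Iwasawa1956, §§3–5] [cite: Washington1997, §13.3 Lemma 13.15 and Thm. 10.4]
[cite: SerreLinearRepresentations1977, §7.2 Thm. 13] [cite: Serre1972, §2.2] -/
theorem equivariantHom_geomTorsion_layer_eq_zero_of_nonsplitCartan_rankEq
    {K : Type} [Field K] [NumberField K] [Fact (Nat.Prime 5)] (κ : ZpExtension K 5)
    (hram : ∃ 𝔓' : Ideal (absIntegers (𝓞 K) K), 𝔓'.IsMaximal ∧
      𝔓'.inertia (absoluteGaloisGroup K) ⊔ κ.kerSubgroup = ⊤)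
    (W : WeierstrassCurve K) [W.IsElliptic]
    [∀ n, FiniteDimensional K (κ.layer n)] [∀ n, IsGalois K (κ.layer n)]
    [∀ n, NumberField ↥(W.divisionField 5 ⊔ κ.layer n)] [NumberField ↥(W.divisionField 5)]
    (e : W.geomTorsion (5 : ℕ) ≃+ (Fin 2 → ZMod 5)) {ε : ZMod 5} (hε : ¬ IsSquare ε)
    (he : ∀ σ : absoluteGaloisGroup K, ∃ M ∈ nonsplitCartanNormalizer ε, ∀ P : W.geomTorsion (5 : ℕ), e (σ • P) = M *ᵥ e P)
    (σx σs : absoluteGaloisGroup K) (hσx : ∀ P : W.geomTorsion (5 : ℕ), e (σx • P) = !![1, ε * (4 - ε); 4 - ε, 1] *ᵥ e P)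
    (hσs : ∀ P : W.geomTorsion (5 : ℕ), e (σs • P) = !![1, 0; 0, 4] *ᵥ e P)
    (hrank : Nat.card {d : ClassGroup (𝓞 ↥(fixedField (Subgroup.zpowers (absRestrictNormalHom (W.divisionField 5) σs)))) // d ^ 5 = 1} =
      Nat.card {d : ClassGroup (𝓞 ↥(fixedField (Subgroup.zpowers (absRestrictNormalHom (W.divisionField 5) σx ^ 12) ⊔
        Subgroup.zpowers (absRestrictNormalHom (W.divisionField 5) σs)))) // d ^ 5 = 1})
    (hcI : ∀ (𝔮 : Ideal (𝓞 ↥(W.divisionField 5))) [𝔮.IsMaximal], ((5 : ℕ) : 𝓞 ↥(W.divisionField 5)) ∈ 𝔮 →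
      absRestrictNormalHom (W.divisionField 5) σx ^ 12 ∈ 𝔮.inertia _)
    (n : ℕ) (f : Additive (ClassGroup (𝓞 ↥(W.divisionField 5 ⊔ κ.layer n))) →+ W.geomTorsion (5 : ℕ))
    (hf : ∀ (τ : absoluteGaloisGroup K) (c : ClassGroup (𝓞 ↥(W.divisionField 5 ⊔ κ.layer n))),
      f (Additive.ofMul (ClassGroup.mulEquiv (AmbiguousClass.intAut
        (absRestrictNormalHom (W.divisionField 5 ⊔ κ.layer n) τ)) c)) = τ • f (Additive.ofMul c)) :
    f = 0 := by
  classical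
  have hε' := eq_two_or_three_of_not_isSquare'' hε
  -- the faithful matrix representation of `Gal(K(E[5])/K)` in the basis `e`
  obtain ⟨ρm, hρm, hρme⟩ := exists_matrixRep_divisionField W 5 e
  have hmat : ∀ (σ : absoluteGaloisGroup K) (M : Matrix (Fin 2) (Fin 2) (ZMod 5)),
      (∀ P, e (σ • P) = M *ᵥ e P) → ρm (absRestrictNormalHom _ σ) = M :=
    fun σ M hM => matrix_eq_of_forall_mulVec'' e fun P => by rw [← hρme, hM]
  have hπ := absRestrictNormalHom_surjective'' (W.divisionField 5)
  have himg : ∀ g, ρm g ∈ nonsplitCartanNormalizer ε := fun g => by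
    obtain ⟨σ, rfl⟩ := hπ g
    obtain ⟨M, hM, hMe⟩ := he σ
    rw [hmat σ M hMe]
    exact hM
  have hG := not_dvd_card_of_forall_pow_24 (W.divisionField 5) (p := 5) (by norm_num) (by norm_num)
    (fun g => hρm (by rw [map_pow, map_one]; exact pow_24_eq_one_of_mem'' hε' (himg g)))
  have hL₀ := not_dvd_finrank_of_not_dvd_card' (W.divisionField 5) hG
  set xb := absRestrictNormalHom (W.divisionField 5) σx with hxb
  set sb := absRestrictNormalHom (W.divisionField 5) σs with hsb
  have hρx : ρm xb = !![1, ε * (4 - ε); 4 - ε, 1] := hmat σx _ hσx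
  have hρs : ρm sb = !![1, 0; 0, 4] := hmat σs _ hσs
  have hx12 : ρm (xb ^ 12) = -1 := by rw [map_pow, hρx]; exact R_pow_twelve' hε'
  have hc : ∀ g, g * xb ^ 12 = xb ^ 12 * g := fun g =>
    hρm (by rw [map_mul, map_mul, hx12, mul_neg_one, neg_one_mul])
  haveI : Fintype ↥(Subgroup.zpowers sb) := Fintype.ofFinite _
  haveI : Fintype ↥(Subgroup.zpowers (xb ^ 12) ⊔ Subgroup.zpowers sb) := Fintype.ofFinite _
  have hpH' := not_dvd_card_subgroup'' _ hG (Subgroup.zpowers (xb ^ 12) ⊔ Subgroup.zpowers sb)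
  -- (1) the rank-equality transfer: every equivariant map into the coset kernel vanishes at layer `n`
  have hvan : ∀ μ : Additive (ClassGroup (𝓞 ↥(W.divisionField 5 ⊔ κ.layer n))) →+
      cosetKernel (Subgroup.zpowers sb) (Subgroup.zpowers (xb ^ 12) ⊔ Subgroup.zpowers sb) (ZMod 5),
      (∀ (τ : absoluteGaloisGroup K) (c : ClassGroup (𝓞 ↥(W.divisionField 5 ⊔ κ.layer n))),
        μ (Additive.ofMul (ClassGroup.mulEquiv (AmbiguousClass.intAut
          (absRestrictNormalHom (W.divisionField 5 ⊔ κ.layer n) τ)) c)) =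
          absRestrictNormalHom (W.divisionField 5) τ • μ (Additive.ofMul c)) → μ = 0 :=
    fun μ hμ => RankEqualityTransfer.equivariantHom_cosetKernel_layer_eq_zero_of_saturated (by norm_num) κ
      (W.divisionField 5) hL₀ hram _ _ le_sup_right hpH' hrank
      (fun 𝔮 _ h𝔮 g h' hh' => saturated_of_central' _ hc _ _ (hcI 𝔮 h𝔮) g h' hh') n μ hμ
  -- (2) the Galois action on `Cl(𝓞_{L·K_n})` as a representation of `Γ_K`
  let ρE : (↥(W.divisionField 5 ⊔ κ.layer n) ≃ₐ[K] ↥(W.divisionField 5 ⊔ κ.layer n)) →*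
      AddMonoid.End (Additive (ClassGroup (𝓞 ↥(W.divisionField 5 ⊔ κ.layer n)))) :=
    { toFun := fun σ => (ClassGroup.mulEquiv (AmbiguousClass.intAut σ)).toMonoidHom.toAdditive
      map_one' := AddMonoidHom.ext fun a => by
        change Additive.ofMul (ClassGroup.mulEquiv (AmbiguousClass.intAut
          (1 : ↥(W.divisionField 5 ⊔ κ.layer n) ≃ₐ[K] ↥(W.divisionField 5 ⊔ κ.layer n))) (Additive.toMul a)) = a
        rw [AmbiguousClass.mulEquiv_intAut_one, MulEquiv.refl_apply, ofMul_toMul]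
      map_mul' := fun σ τ => AddMonoidHom.ext fun a => by
        change Additive.ofMul (ClassGroup.mulEquiv (AmbiguousClass.intAut (σ * τ)) (Additive.toMul a)) =
          Additive.ofMul (ClassGroup.mulEquiv (AmbiguousClass.intAut σ)
            (Additive.toMul (Additive.ofMul (ClassGroup.mulEquiv (AmbiguousClass.intAut τ) (Additive.toMul a)))))
        rw [AmbiguousClass.mulEquiv_intAut_mul, MulEquiv.trans_apply, toMul_ofMul] }
  let ρA : absoluteGaloisGroup K →* AddMonoid.End (Additive (ClassGroup (𝓞 ↥(W.divisionField 5 ⊔ κ.layer n)))) :=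
    ρE.comp (absRestrictNormalHom (W.divisionField 5 ⊔ κ.layer n))
  have hfρ : ∀ (τ : absoluteGaloisGroup K) (a : Additive (ClassGroup (𝓞 ↥(W.divisionField 5 ⊔ κ.layer n)))),
      f (ρA τ a) = τ • f a := fun τ a => hf τ (Additive.toMul a)
  -- (3) the character «first coordinate of `f`»
  let lam : W.geomTorsion (5 : ℕ) →+ ZMod 5 := (Pi.evalAddMonoidHom (fun _ : Fin 2 => ZMod 5) 0).comp e.toAddMonoidHom
  let ν : Additive (ClassGroup (𝓞 ↥(W.divisionField 5 ⊔ κ.layer n))) →+ ZMod 5 := lam.comp f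
  have hν : ∀ a, ν a = (e (f a)) 0 := fun _ => rfl
  -- `ν` is `H`-invariant (`σ̄_s = diag(1,4)` fixes the first coordinate)
  have hνH : ∀ τ : absoluteGaloisGroup K, absRestrictNormalHom (W.divisionField 5) τ ∈ Subgroup.zpowers sb →
      ∀ a, ν (ρA τ a) = ν a := by
    intro τ hτ a
    rw [hν, hν, hfρ, hρme]
    rw [← (isOfFinOrder_of_finite sb).mem_powers_iff_mem_zpowers] at hτ
    obtain ⟨k, hk⟩ := (Submonoid.mem_powers_iff _ _).mp hτ
    rw [← hk, map_pow, hρs]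
    exact diag14_pow_mulVec_zero k _
  -- `#H'` is invertible in `𝔽₅`
  obtain ⟨u, hu⟩ : ∃ u : ℤ, ∀ r : ZMod 5,
      u • (Fintype.card ↥(Subgroup.zpowers (xb ^ 12) ⊔ Subgroup.zpowers sb) • r) = r := by
    have h0 : ((Fintype.card ↥(Subgroup.zpowers (xb ^ 12) ⊔ Subgroup.zpowers sb) : ℕ) : ZMod 5) ≠ 0 :=
      fun h => hpH' ((ZMod.natCast_eq_zero_iff _ _).mp h)
    refine ⟨((((Fintype.card ↥(Subgroup.zpowers (xb ^ 12) ⊔ Subgroup.zpowers sb) : ℕ) : ZMod 5)⁻¹).val : ℕ), fun r => ?_⟩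
    rw [nsmul_eq_mul, zsmul_eq_mul, Int.cast_natCast, ZMod.natCast_zmod_val, ← mul_assoc, inv_mul_cancel₀ h0, one_mul]
  -- a section of `Γ_K → Gal(L/K)`
  have hsec : ∀ g, absRestrictNormalHom (W.divisionField 5) (Function.surjInv hπ g) = g := Function.surjInv_eq hπ
  -- (4) Frobenius reciprocity: `ν` is `H'`-invariant
  have hνH' := invariant_lift_of_forall_equivariantHom_eq_zero (Subgroup.zpowers sb)
    (Subgroup.zpowers (xb ^ 12) ⊔ Subgroup.zpowers sb) (ZMod 5) (absRestrictNormalHom (W.divisionField 5)) ρA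
    le_sup_right (Function.surjInv hπ) hsec u hu (fun μ hμ => hvan μ fun τ c => hμ τ (Additive.ofMul c)) ν hνH
  -- (5) at `σ_x¹²` (acting as `−1`): `ν = 0`
  have hx12mem : absRestrictNormalHom (W.divisionField 5) (σx ^ 12) ∈
      Subgroup.zpowers (xb ^ 12) ⊔ Subgroup.zpowers sb := by
    rw [map_pow]
    exact Subgroup.mem_sup_left (Subgroup.mem_zpowers _)
  have hν0 : ∀ a, (e (f a)) 0 = 0 := fun a => by
    have h1 := hνH' (σx ^ 12) hx12mem a
    rw [hν, hν, hfρ, hρme, map_pow, ← hxb, hx12, Matrix.neg_mulVec, Matrix.one_mulVec, Pi.neg_apply] at h1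
    exact zmod5_eq_zero_of_neg_eq _ h1
  -- (6) at `σ_x`: the second coordinate vanishes too
  have hcoord : ∀ a, e (f a) = 0 := fun a => by
    have h0 := hν0 a
    have h1 := hν0 (ρA σx a)
    rw [hfρ, hρme, ← hxb, hρx, R_mulVec_zero, h0, zero_add] at h1
    have h2 : (e (f a)) 1 = 0 := (mul_eq_zero.mp h1).resolve_left (eps_mul_ne_zero hε')
    funext i
    fin_cases i
    · exact h0
    · exact h2
  exact AddMonoidHom.ext fun a => e.injective ((hcoord a).trans (map_zero e).symm)

/-! ### §2 Statement (A) at `(E, 5)` from the rank equality (over `ℚ`) -/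

set_option maxHeartbeats 1600000 in
set_option synthInstance.maxHeartbeats 400000 in
/-- **(A) at `(E, 5)` for a `C_ns⁺(5)`-row FROM THE RANK EQUALITY — no named fact, no `μ`-hypothesis.**  `E/ℚ` elliptic with `Γ_ℚ` acting on `E[5]`
through `C_ns⁺(ε)` in the basis `e` (`σ_x ↦ R_ε`, `σ_s ↦ diag(1,4)`); if `#Cl(ℚ(P))[5] = #Cl(ℚ(x(P)))[5]` (`ℚ(P) = ℚ(E[5])^{⟨σ̄_s⟩}`,
`ℚ(x(P)) = ℚ(E[5])^{⟨σ̄_x¹², σ̄_s⟩}`) and `σ̄_x¹² ∈ I(𝔮)` for every prime `𝔮 ∋ 5` of `ℚ(E[5])`, then the dual fine Selmer group of `E` over `ℚ_cyc` is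
finitely generated over `ℤ_5`, for every cyclotomic `ℤ_5`-extension (door L5 `CoatesSujatha2005.conjA_of_homTrivial_layer_above_p` at layer 1 fed by §1;
(c1) `5 ∤ #Gal(ℚ(E[5])/ℚ)` is automatic). [cite: CoatesSujatha2005, §3 Thm. 3.4 and Lemma 3.8] [cite: DeoRaySujatha2023, §3 Thm. 3.8 (arXiv:2202.09937 p. 9)]
[cite: Iwasawa1956, §§3–5] [cite: Serre1972, §2.2] -/
theorem conjA_five_of_nonsplitCartanBasis_of_rankEq (W : WeierstrassCurve ℚ) [W.IsElliptic]
    (e : W.geomTorsion (5 : ℕ) ≃+ (Fin 2 → ZMod 5)) {ε : ZMod 5} (hε : ¬ IsSquare ε)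
    (he : ∀ σ : absoluteGaloisGroup ℚ, ∃ M ∈ nonsplitCartanNormalizer ε, ∀ P : W.geomTorsion (5 : ℕ), e (σ • P) = M *ᵥ e P)
    (σx σs : absoluteGaloisGroup ℚ) (hσx : ∀ P : W.geomTorsion (5 : ℕ), e (σx • P) = !![1, ε * (4 - ε); 4 - ε, 1] *ᵥ e P)
    (hσs : ∀ P : W.geomTorsion (5 : ℕ), e (σs • P) = !![1, 0; 0, 4] *ᵥ e P)
    (hrank : Nat.card {d : ClassGroup (𝓞 ↥(fixedField (Subgroup.zpowers (absRestrictNormalHom (W.divisionField 5) σs)))) // d ^ 5 = 1} =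
      Nat.card {d : ClassGroup (𝓞 ↥(fixedField (Subgroup.zpowers (absRestrictNormalHom (W.divisionField 5) σx ^ 12) ⊔
        Subgroup.zpowers (absRestrictNormalHom (W.divisionField 5) σs)))) // d ^ 5 = 1})
    (hcI : ∀ (𝔮 : Ideal (𝓞 ↥(W.divisionField 5))) [𝔮.IsMaximal], ((5 : ℕ) : 𝓞 ↥(W.divisionField 5)) ∈ 𝔮 →
      absRestrictNormalHom (W.divisionField 5) σx ^ 12 ∈ 𝔮.inertia _)
    (κ : ZpExtension ℚ 5) (hκ : κ.IsCyclotomic) :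
    ∃ (γ : absoluteGaloisGroup ℚ) (D : W.FineSelmerDualData κ γ),
      Module.Finite ℤ_[5] (RestrictScalars ℤ_[5] (IwasawaAlgebra 5) D.X) := by
  classical
  haveI : Fact (Nat.Prime 5) := ⟨by norm_num⟩
  have hε' := eq_two_or_three_of_not_isSquare'' hε
  obtain ⟨ρm, hρm, hρme⟩ := exists_matrixRep_divisionField W 5 e
  have hmat : ∀ (σ : absoluteGaloisGroup ℚ) (M : Matrix (Fin 2) (Fin 2) (ZMod 5)),
      (∀ P, e (σ • P) = M *ᵥ e P) → ρm (absRestrictNormalHom _ σ) = M :=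
    fun σ M hM => matrix_eq_of_forall_mulVec'' e fun P => by rw [← hρme, hM]
  have hπ := absRestrictNormalHom_surjective'' (W.divisionField 5)
  have himg : ∀ g, ρm g ∈ nonsplitCartanNormalizer ε := fun g => by
    obtain ⟨σ, rfl⟩ := hπ g
    obtain ⟨M, hM, hMe⟩ := he σ
    rw [hmat σ M hMe]
    exact hM
  have hG := not_dvd_card_of_forall_pow_24 (W.divisionField 5) (p := 5) (by norm_num) (by norm_num)
    (fun g => hρm (by rw [map_pow, map_one]; exact pow_24_eq_one_of_mem'' hε' (himg g)))
  haveI := fun m => κ.isGalois_layer_holds m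
  haveI := fun m => κ.finiteDimensional_layer_holds m
  haveI hNF : ∀ m, NumberField ↥(W.divisionField 5 ⊔ κ.layer m) := fun m => NumberField.of_module_finite ℚ _
  haveI : NumberField ↥(W.divisionField 5) := NumberField.mk
  have hram := EquivariantIwasawaLemma.exists_isMaximal_inertia_sup_kerSubgroup_eq_top_of_isCyclotomic hκ
  exact CoatesSujatha2005.conjA_of_homTrivial_layer_above_p W (by decide) hG hκ 0 (fun f hf _ =>
    equivariantHom_geomTorsion_layer_eq_zero_of_nonsplitCartan_rankEq κ hram W e hε he σx σs hσx hσs hrank hcI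
      (0 + 1) f hf)

end RankEqualityRoad

end Literature.NumberTheory.EllipticCurves.CoatesSujatha2005

end
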